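import Summits.Ventures.Crystal3D.Theorems.StickyWulffConstantTextureBuildMassCells
import Summits.Ventures.Crystal3D.Theorems.StickyWulffConstantTextureLiminfTentFrameWulff
import HarnessLib

/-!
# TB-D: MASS BRICK (M4-fcc) — the twelve-neighbour cell of an fcc site has volume `1/√2`
# (lane T, crux `TextureLiminfV5`, stmt-Ventures-23912; design memo TB-D-0 §3 (M4) «the one real computation», §5; helper seat wulff-tb-w1; part 3 of the MASS bricks)

HONEST FRAMING. Venture `Summits/Ventures/Crystal3D` (cell `crystal3d-full`), route `route-Ventures-StickyWulffConstant`, helper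
`--supports` the law-v5 crux `TextureLiminfV5` (stmt-Ventures-23912).  Measure theory of the reference fcc lattice `fccRef` of the line
(census-free, standard axioms); nothing about any texture, cover or mesh; F-C1 not moved.

ROUTE (TB-D-0 §3 (M4), route A): the open twelve-neighbour cell `C₀ = {z | ∀ w ∈ fccRef, dist 0 w = 1 → dist z 0 < dist z w}` of the origin in
the reference lattice (the open rhombic dodecahedron) is an a.e. FUNDAMENTAL DOMAIN of the `ℤ`-lattice `fccRef = ℤu ⊕ ℤv ⊕ ℤ(w + h e₃)`
(Mathlib `IsAddFundamentalDomain`): its lattice translates are disjoint because the cell lies in `ball 0 (√2/2)` ((M3), `…TextureBuildMassCells`)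
and two lattice points closer than `√2` are nearest neighbours (`…TextureBuildBarlowShells`), whose two cells are separated by their bisector; they
cover almost every point because a nearest lattice point exists (discreteness + covering radius) and the bisector planes are null.  Hence
`volume C₀ = covolume = |det(u, v, w + h e₃)| = (√3/2)·√(2/3) = √2/2` (`ZLattice.covolume`, the unit cube of the orthonormal frame has volume `1`).

* `fccGen`, `linearIndependent_fccGen`, `fccBasis`, `coe_span_fccBasis : ↑(span ℤ (range fccBasis)) = fccRef`, `abs_det_fccBasis`, `volume_fundamentalDomain_fccBasis`;
* `exists_nearest_fccRef` (a nearest lattice point), `isAddFundamentalDomain_cell₀`;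
* **`volume_cell₁₂_fccRef_zero : volume C₀ = ENNReal.ofReal (√2/2)`**;
* **`volume_cell₁₂_of_mem_stacking_constHagg`** — for every site `a` of a moved fcc stacking `stacking L s constHagg`,
  `volume {z | ∀ v ∈ stacking L s constHagg, dist a v = 1 → dist z a < dist z v} = ENNReal.ofReal (√2/2)` (rigid motions preserve volume).
(M4) for ALL sites (hcp-like shells included) is the sequel `…TextureBuildBarlowCellVolume` (half-cell argument on top of this reference volume).
-/

noncomputable section

open scoped BigOperators InnerProductSpace

namespace Summit.Ventures.Crystal3D.Cruxes.TextureLiminf.TexShadow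

open Summit.Ventures.Crystal3D Metric MeasureTheory Module Submodule
open Summit.Ventures.Crystal3D.TentCertificate (hB hB_sq hB_pos zero_mem_fccRef sub_mem_fccRef)
open Literature.MathematicalPhysics.StatisticalMechanics (barlowPos barlowStacking barlowPos_mem IsHaggSeq haggLabel constHagg
  haggLabel_const isHaggSeq_const fccStacking triangularVec₁ triangularVec₂ barlowOffset layerNormal mem_barlowStacking_iff
  barlowPos_apply_zero barlowPos_apply_one barlowPos_apply_two)

/-! ### The reference lattice `fccRef` as a `ℤ`-span of a real basis -/

/-- The three generators `u = (1,0,0)`, `v = (1/2, √3/2, 0)`, `t = w + h e₃ = (1/2, √3/6, √(2/3))` of the reference fcc lattice in the Barlow frame. -/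
def fccGen : Fin 3 → E3 := ![triangularVec₁ 1, triangularVec₂ 1, barlowOffset 1 + layerNormal hB]

/-- Coordinates of the generators. -/
theorem fccGen_apply :
    (fccGen 0) 0 = 1 ∧ (fccGen 0) 1 = 0 ∧ (fccGen 0) 2 = 0 ∧ (fccGen 1) 0 = 1 / 2 ∧ (fccGen 1) 1 = Real.sqrt 3 / 2 ∧ (fccGen 1) 2 = 0 ∧
      (fccGen 2) 0 = 1 / 2 ∧ (fccGen 2) 1 = Real.sqrt 3 / 6 ∧ (fccGen 2) 2 = hB := by
  simp [fccGen, triangularVec₁, triangularVec₂, barlowOffset, layerNormal]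

/-- An fcc site is the integer combination `i u + j v + k t` of the generators. -/
theorem barlowPos_constHagg_eq (k i j : ℤ) :
    barlowPos 1 hB constHagg k i j = (i : ℝ) • fccGen 0 + (j : ℝ) • fccGen 1 + (k : ℝ) • fccGen 2 := by
  simp only [barlowPos, haggLabel_const, fccGen, Matrix.cons_val_zero, Matrix.cons_val_one, Matrix.cons_val_two, Matrix.head_cons,
    Matrix.tail_cons, smul_add]
  abel

/-- The generators are linearly independent (the coordinate matrix is triangular with diagonal `1, √3/2, √(2/3)`). -/
theorem linearIndependent_fccGen : LinearIndependent ℝ fccGen := by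
  rw [Fintype.linearIndependent_iff]
  intro g hg i
  obtain ⟨h00, h01, h02, h10, h11, h12, h20, h21, h22⟩ := fccGen_apply
  have e0 := congrArg (fun x : E3 => x 0) hg
  have e1 := congrArg (fun x : E3 => x 1) hg
  have e2 := congrArg (fun x : E3 => x 2) hg
  simp only [Fin.sum_univ_three, PiLp.add_apply, PiLp.smul_apply, smul_eq_mul, PiLp.zero_apply, h00, h01, h02, h10, h11, h12, h20, h21,
    h22] at e0 e1 e2
  have hs3 : 0 < Real.sqrt 3 := by positivity
  have hh : 0 < hB := hB_pos
  have g2 : g 2 = 0 := by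
    rcases mul_eq_zero.1 (show g 2 * hB = 0 by linarith) with h | h
    · exact h
    · exact absurd h hh.ne'
  have g1 : g 1 = 0 := by nlinarith
  have g0 : g 0 = 0 := by nlinarith
  fin_cases i
  · exact g0
  · exact g1
  · exact g2

/-- The generators as a real basis of `E3`. -/
def fccBasis : Basis (Fin 3) ℝ E3 :=
  basisOfLinearIndependentOfCardEqFinrank linearIndependent_fccGen (by simp)

/-- `fccBasis i = fccGen i`. -/
@[simp] theorem fccBasis_apply (i : Fin 3) : fccBasis i = fccGen i := by
  rw [fccBasis, coe_basisOfLinearIndependentOfCardEqFinrank]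

/-- **The reference lattice is the `ℤ`-span of the basis**: `↑(span ℤ (range fccBasis)) = fccRef`. -/
theorem coe_span_fccBasis : (↑(span ℤ (Set.range (⇑fccBasis))) : Set E3) = fccRef := by
  ext x
  rw [SetLike.mem_coe, Submodule.mem_span_range_iff_exists_fun]
  constructor
  · rintro ⟨c, rfl⟩
    refine ⟨c 2, c 0, c 1, ?_⟩
    rw [barlowPos_constHagg_eq, Fin.sum_univ_three]
    simp only [fccBasis_apply, ← Int.cast_smul_eq_zsmul ℝ]
  · rintro ⟨k, i, j, rfl⟩
    refine ⟨![i, j, k], ?_⟩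
    rw [barlowPos_constHagg_eq, Fin.sum_univ_three]
    simp only [fccBasis_apply, ← Int.cast_smul_eq_zsmul ℝ, Matrix.cons_val_zero, Matrix.cons_val_one, Matrix.cons_val_two,
      Matrix.head_cons, Matrix.tail_cons]

/-- Membership form of `coe_span_fccBasis`. -/
theorem mem_span_fccBasis_iff (x : E3) : x ∈ span ℤ (Set.range (⇑fccBasis)) ↔ x ∈ fccRef := by
  rw [← SetLike.mem_coe, coe_span_fccBasis]

/-- **`|det (u, v, t)| = √2/2`** in the orthonormal frame. -/
theorem abs_det_fccBasis : |(EuclideanSpace.basisFun (Fin 3) ℝ).toBasis.det fccBasis| = Real.sqrt 2 / 2 := by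
  obtain ⟨h00, h01, h02, h10, h11, h12, h20, h21, h22⟩ := fccGen_apply
  have h32 : Real.sqrt 3 * hB = Real.sqrt 2 := by
    rw [show (hB : ℝ) = Real.sqrt (2 / 3) from rfl, ← Real.sqrt_mul (by norm_num)]
    norm_num
  have hdet : (EuclideanSpace.basisFun (Fin 3) ℝ).toBasis.det fccBasis = Real.sqrt 2 / 2 := by
    rw [Basis.det_apply, Matrix.det_fin_three]
    simp only [Basis.toMatrix_apply, OrthonormalBasis.coe_toBasis_repr_apply, EuclideanSpace.basisFun_repr, fccBasis_apply, h00, h01,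
      h02, h10, h11, h12, h20, h21, h22]
    linear_combination (1 / 2 : ℝ) * h32
  rw [hdet, abs_of_nonneg (by positivity)]

/-- The volume of the basis' fundamental parallelotope: `volume (fundamentalDomain fccBasis) = √2/2`. -/
theorem volume_fundamentalDomain_fccBasis : volume (ZSpan.fundamentalDomain fccBasis) = ENNReal.ofReal (Real.sqrt 2 / 2) := by
  rw [ZSpan.measure_fundamentalDomain fccBasis volume (EuclideanSpace.basisFun (Fin 3) ℝ).toBasis, abs_det_fccBasis,
    measure_congr (ZSpan.fundamentalDomain_ae_parallelepiped (EuclideanSpace.basisFun (Fin 3) ℝ).toBasis volume),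
    OrthonormalBasis.coe_toBasis, (EuclideanSpace.basisFun (Fin 3) ℝ).volume_parallelepiped, mul_one]

/-! ### The reference twelve-neighbour cell -/

/-- `fccRef` is the unmoved stacking `stacking (refl) 0 constHagg`. -/
theorem stacking_refl_zero_constHagg : stacking (LinearIsometryEquiv.refl ℝ E3) 0 constHagg = fccRef := by
  unfold stacking
  simp only [LinearIsometryEquiv.coe_refl, id_eq, add_zero, Set.image_id']
  rfl

/-- `fccRef` is closed under addition (it is the `ℤ`-span; subtraction and negation: `TentCertificate.sub_mem_fccRef`, `neg_mem_fccRef`). -/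
theorem add_mem_fccRef {x y : E3} (hx : x ∈ fccRef) (hy : y ∈ fccRef) : x + y ∈ fccRef := by
  rw [← mem_span_fccBasis_iff] at hx hy ⊢; exact add_mem hx hy

/-- **(M3) for the reference cell**: the twelve-neighbour cell of `0` in `fccRef` lies in `ball 0 (√2/2)`. -/
theorem norm_lt_of_mem_cell₀ {z : E3} (hz : z ∈ {z : E3 | ∀ w ∈ fccRef, dist (0 : E3) w = 1 → dist z 0 < dist z w}) :
    ‖z‖ < Real.sqrt 2 / 2 := by
  have h0 : (0 : E3) ∈ stacking (LinearIsometryEquiv.refl ℝ E3) 0 constHagg := by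
    rw [stacking_refl_zero_constHagg]; exact zero_mem_fccRef
  have hz' : z ∈ {z : E3 | ∀ w ∈ stacking (LinearIsometryEquiv.refl ℝ E3) 0 constHagg, dist (0 : E3) w = 1 → dist z 0 < dist z w} := by
    rw [stacking_refl_zero_constHagg]; exact hz
  have h := dist_lt_of_mem_cell₁₂ isHaggSeq_const h0 hz'
  rwa [dist_zero_right] at h

/-- The reference cell is open. -/
theorem isOpen_cell₀ : IsOpen {z : E3 | ∀ w ∈ fccRef, dist (0 : E3) w = 1 → dist z 0 < dist z w} := by
  have h0 : (0 : E3) ∈ stacking (LinearIsometryEquiv.refl ℝ E3) 0 constHagg := by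
    rw [stacking_refl_zero_constHagg]; exact zero_mem_fccRef
  have h := isOpen_cell₁₂ isHaggSeq_const h0
  rwa [stacking_refl_zero_constHagg] at h

/-- The reference cell is bounded (hence of finite volume). -/
theorem isBounded_cell₀ : Bornology.IsBounded {z : E3 | ∀ w ∈ fccRef, dist (0 : E3) w = 1 → dist z 0 < dist z w} :=
  (Metric.isBounded_ball (x := (0 : E3)) (r := Real.sqrt 2 / 2)).subset fun z hz => by
    rw [Metric.mem_ball, dist_zero_right]; exact norm_lt_of_mem_cell₀ hz

/-- Distinct points of `fccRef` closer than `√2` are nearest neighbours. -/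
theorem dist_eq_one_of_dist_lt_sqrt_two {x y : E3} (hx : x ∈ fccRef) (hy : y ∈ fccRef) (hne : x ≠ y) (hd : dist x y < Real.sqrt 2) :
    dist x y = 1 := by
  rw [← stacking_refl_zero_constHagg] at hx hy
  by_contra h1
  have := sqrt_two_le_dist_of_mem_stacking isHaggSeq_const hx hy hne h1
  linarith

/-- **A nearest lattice point exists**: every `x` has `g ∈ fccRef` with `dist x g ≤ dist x w` for all `w ∈ fccRef`. -/
theorem exists_nearest_fccRef (x : E3) : ∃ g ∈ fccRef, ∀ w ∈ fccRef, dist x g ≤ dist x w := by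
  -- the lattice points within `1` of `x`: finite (discrete lattice) and nonempty (covering radius `√2/2`)
  have hfin : (Metric.closedBall x 1 ∩ fccRef).Finite := by
    rw [← coe_span_fccBasis]
    exact ZSpan.setFinite_inter fccBasis Metric.isBounded_closedBall
  obtain ⟨b, hb, hbd⟩ := exists_mem_stacking_dist_sq_le_half (LinearIsometryEquiv.refl ℝ E3) 0 constHagg x
  rw [stacking_refl_zero_constHagg] at hb
  have hb1 : dist x b ≤ 1 := by nlinarith [dist_nonneg (x := x) (y := b)]
  have hne : (Metric.closedBall x 1 ∩ fccRef).Nonempty := ⟨b, Metric.mem_closedBall.2 (by rw [dist_comm]; exact hb1), hb⟩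
  obtain ⟨g, hg, hmin⟩ := Set.exists_min_image _ (fun y => dist x y) hfin hne
  refine ⟨g, hg.2, fun w hw => ?_⟩
  by_cases hw1 : dist x w ≤ 1
  · exact hmin w ⟨Metric.mem_closedBall.2 (by rw [dist_comm]; exact hw1), hw⟩
  · push Not at hw1
    have hg1 : dist x g ≤ 1 := by
      have := hg.1; rw [Metric.mem_closedBall, dist_comm] at this; exact this
    linarith

/-! ### The cell is an a.e. fundamental domain of the lattice -/

/-- The bisector planes of the lattice: a countable union of null hyperplanes. -/
theorem volume_bisectors_eq_zero :
    volume (⋃ g ∈ fccRef, ⋃ w ∈ {w : E3 | w ∈ fccRef ∧ dist (0 : E3) w = 1}, {x : E3 | ⟪w, x - g⟫_ℝ = 1 / 2}) = 0 := by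
  have hcount : fccRef.Countable :=
    (Set.countable_range (fun p : ℤ × ℤ × ℤ => barlowPos 1 hB constHagg p.1 p.2.1 p.2.2)).mono fun x hx => by
      obtain ⟨k, i, j, rfl⟩ := hx
      exact ⟨(k, i, j), rfl⟩
  have hcount' : {w : E3 | w ∈ fccRef ∧ dist (0 : E3) w = 1}.Countable := hcount.mono fun w hw => hw.1
  refine (measure_biUnion_null_iff hcount).2 fun g _ => (measure_biUnion_null_iff hcount').2 fun w hw => ?_
  have hw0 : w ≠ 0 := by
    intro h
    have hw' : dist (0 : E3) w = 1 := hw.2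
    rw [h, dist_self] at hw'
    exact zero_ne_one hw'
  have : {x : E3 | ⟪w, x - g⟫_ℝ = 1 / 2} = {x : E3 | ⟪w, x⟫_ℝ = 1 / 2 + ⟪w, g⟫_ℝ} := by
    ext x; simp only [Set.mem_setOf_eq, inner_sub_right]; constructor <;> intro h <;> linarith
  rw [this]
  exact Summit.Ventures.Crystal3D.Theorems.volume_setOf_inner_eq_zero hw0 _

/-- **The reference cell is an a.e. fundamental domain of the fcc lattice `span ℤ (range fccBasis)`.** -/
theorem isAddFundamentalDomain_cell₀ :
    IsAddFundamentalDomain (span ℤ (Set.range (⇑fccBasis))) {z : E3 | ∀ w ∈ fccRef, dist (0 : E3) w = 1 → dist z 0 < dist z w} volume where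
  nullMeasurableSet := isOpen_cell₀.measurableSet.nullMeasurableSet
  ae_covers := by
    rw [Filter.Eventually, mem_ae_iff]
    refine measure_mono_null ?_ volume_bisectors_eq_zero
    intro x hx
    rw [Set.mem_compl_iff, Set.mem_setOf_eq, not_exists] at hx
    obtain ⟨g, hg, hnear⟩ := exists_nearest_fccRef x
    -- `-g +ᵥ x = x - g` is not in the cell, so some neighbour comparison is not strict: `x` is on a bisector
    have hg' : -g ∈ span ℤ (Set.range (⇑fccBasis)) := neg_mem ((mem_span_fccBasis_iff g).2 hg)
    have hx' := hx ⟨-g, hg'⟩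
    rw [Submodule.vadd_def, vadd_eq_add, Set.mem_setOf_eq] at hx'
    push Not at hx'
    obtain ⟨w, hw, hw1, hle⟩ := hx'
    have hge : dist (-g + x) 0 ≤ dist (-g + x) w := by
      have h1 : dist (-g + x) 0 = dist x g := by rw [dist_eq_norm, dist_eq_norm]; congr 1; abel
      have h2 : dist (-g + x) w = dist x (g + w) := by rw [dist_eq_norm, dist_eq_norm]; congr 1; abel
      rw [h1, h2]; exact hnear (g + w) (add_mem_fccRef hg hw)
    have heq : dist (-g + x) 0 = dist (-g + x) w := le_antisymm hge hle
    refine Set.mem_iUnion₂.2 ⟨g, hg, Set.mem_iUnion₂.2 ⟨w, ⟨hw, hw1⟩, ?_⟩⟩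
    -- `dist p 0 = dist p w` with `‖w‖ = 1` means `⟪w, p⟫ = 1/2`
    have hw1' : ‖w‖ = 1 := by rwa [dist_zero_left] at hw1
    rw [Set.mem_setOf_eq]
    have e : dist (-g + x) w ^ 2 = dist (-g + x) 0 ^ 2 - 2 * ⟪-g + x, w⟫_ℝ + 1 := by
      rw [dist_eq_norm, dist_eq_norm, sub_zero, norm_sub_sq_real, hw1', one_pow]
    rw [heq] at e
    rw [show x - g = -g + x by abel, real_inner_comm]
    linarith
  aedisjoint := by
    intro g₁ g₂ hne
    refine Disjoint.aedisjoint (Set.disjoint_left.2 fun x hx₁ hx₂ => hne ?_)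
    rw [Set.mem_vadd_set] at hx₁ hx₂
    obtain ⟨p₁, hp₁, rfl⟩ := hx₁
    obtain ⟨p₂, hp₂, he⟩ := hx₂
    rw [Submodule.vadd_def, vadd_eq_add] at he
    simp only [Submodule.vadd_def, vadd_eq_add] at he
    -- the two lattice points are within `√2`, hence equal or nearest neighbours
    have hg₁ : (g₁ : E3) ∈ fccRef := (mem_span_fccBasis_iff _).1 g₁.2
    have hg₂ : (g₂ : E3) ∈ fccRef := (mem_span_fccBasis_iff _).1 g₂.2
    have hn₁ := norm_lt_of_mem_cell₀ hp₁
    have hn₂ := norm_lt_of_mem_cell₀ hp₂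
    by_contra hne'
    have hne'' : (g₁ : E3) ≠ g₂ := fun h => hne' (Subtype.ext h)
    have hp₂e' : p₂ = (g₁ : E3) + p₁ - g₂ := by rw [← he]; abel
    have hd : dist (g₁ : E3) g₂ < Real.sqrt 2 := by
      have : (g₁ : E3) - g₂ = p₂ - p₁ := by rw [hp₂e']; abel
      rw [dist_eq_norm, this]
      calc ‖p₂ - p₁‖ ≤ ‖p₂‖ + ‖p₁‖ := norm_sub_le _ _
        _ < Real.sqrt 2 / 2 + Real.sqrt 2 / 2 := add_lt_add hn₂ hn₁
        _ = Real.sqrt 2 := by ring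
    have h1 := dist_eq_one_of_dist_lt_sqrt_two hg₁ hg₂ hne'' hd
    -- `w = g₂ - g₁` is a unit lattice vector; `p₁` is closer to `0` than to `w`, `p₂` closer to `0` than to `-w`
    set w : E3 := (g₂ : E3) - g₁ with hw
    have hwmem : w ∈ fccRef := sub_mem_fccRef hg₂ hg₁
    have hw1 : dist (0 : E3) w = 1 := by rw [dist_zero_left, hw, ← dist_eq_norm, dist_comm, h1]
    have hnw : -w ∈ fccRef := by rw [hw, neg_sub]; exact sub_mem_fccRef hg₁ hg₂
    have hnw1 : dist (0 : E3) (-w) = 1 := by rw [dist_zero_left, norm_neg, ← dist_zero_left, hw1]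
    have c1 := hp₁ w hwmem hw1
    have c2 := hp₂ (-w) hnw hnw1
    have hp₂e : p₂ = p₁ - w := by
      rw [hp₂e', hw]; abel
    rw [hp₂e, dist_eq_norm, dist_eq_norm, sub_zero, show p₁ - w - -w = p₁ by abel] at c2
    rw [dist_eq_norm, dist_eq_norm, sub_zero] at c1
    exact absurd c1 (not_lt.2 c2.le)

/-- **(M4-fcc) The reference twelve-neighbour cell has volume `√2/2 = 1/√2`.** -/
theorem volume_cell₁₂_fccRef_zero :
    volume {z : E3 | ∀ w ∈ fccRef, dist (0 : E3) w = 1 → dist z 0 < dist z w} = ENNReal.ofReal (Real.sqrt 2 / 2) := by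
  have h1 := ZLattice.covolume_eq_measure_fundamentalDomain (span ℤ (Set.range (⇑fccBasis))) volume isAddFundamentalDomain_cell₀
  have h2 := ZLattice.covolume_eq_measure_fundamentalDomain (span ℤ (Set.range (⇑fccBasis))) volume
    (ZSpan.isAddFundamentalDomain fccBasis volume)
  have h3 : volume.real (ZSpan.fundamentalDomain fccBasis) = Real.sqrt 2 / 2 := by
    rw [measureReal_def, volume_fundamentalDomain_fccBasis, ENNReal.toReal_ofReal (by positivity)]
  have hfin : volume {z : E3 | ∀ w ∈ fccRef, dist (0 : E3) w = 1 → dist z 0 < dist z w} ≠ ⊤ := isBounded_cell₀.measure_lt_top.ne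
  rw [← ENNReal.ofReal_toReal hfin, ← measureReal_def, ← h1, h2, h3]

/-! ### Transport to every site of a moved fcc stacking -/

/-- The rigid motion `z ↦ L (r + z) + s` carries the reference cell of `0` onto the cell of the site `a = L r + s` of `stacking L s constHagg`
(`r ∈ fccRef`; the lattice is invariant under translation by `r`). -/
theorem cell₁₂_eq_image {L : E3 ≃ₗᵢ[ℝ] E3} {s r : E3} (hr : r ∈ fccRef) :
    {z : E3 | ∀ v ∈ stacking L s constHagg, dist (L r + s) v = 1 → dist z (L r + s) < dist z v} =
      (fun z => L (r + z) + s) '' {z : E3 | ∀ w ∈ fccRef, dist (0 : E3) w = 1 → dist z 0 < dist z w} := by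
  have hS : ∀ v : E3, v ∈ stacking L s constHagg ↔ ∃ w ∈ fccRef, v = L (r + w) + s := by
    intro v
    constructor
    · rintro ⟨q, hq, rfl⟩
      exact ⟨q - r, sub_mem_fccRef hq hr, by rw [add_sub_cancel]⟩
    · rintro ⟨w, hw, rfl⟩
      exact ⟨r + w, add_mem_fccRef hr hw, rfl⟩
  have hd : ∀ p q : E3, dist (L (r + p) + s) (L (r + q) + s) = dist p q := by
    intro p q; rw [dist_add_right, LinearIsometryEquiv.dist_map, dist_add_left]
  ext z
  simp only [Set.mem_setOf_eq, Set.mem_image]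
  constructor
  · intro hz
    refine ⟨L.symm (z - s) - r, fun w hw hw1 => ?_, by simp⟩
    have hv := hz (L (r + w) + s) ((hS _).2 ⟨w, hw, rfl⟩)
    have e1 : dist (L r + s) (L (r + w) + s) = dist (0 : E3) w := by rw [← hd 0 w, add_zero]
    have e2 : z = L (r + (L.symm (z - s) - r)) + s := by simp
    rw [e1] at hv
    have hv' := hv hw1
    rw [e2, show L r + s = L (r + 0) + s by rw [add_zero], hd, hd] at hv'
    exact hv'
  · rintro ⟨p, hp, rfl⟩ v hv hv1
    obtain ⟨w, hw, rfl⟩ := (hS v).1 hv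
    rw [show L r + s = L (r + 0) + s by rw [add_zero], hd] at hv1 ⊢
    rw [hd]
    exact hp w hw hv1

/-- The rigid motion `z ↦ L (r + z) + s` preserves Lebesgue measure. -/
theorem measurePreserving_move (L : E3 ≃ₗᵢ[ℝ] E3) (s r : E3) : MeasurePreserving (fun z : E3 => L (r + z) + s) volume volume := by
  have h1 : MeasurePreserving (fun z : E3 => r + z) volume volume := measurePreserving_add_left volume r
  have h2 : MeasurePreserving (⇑L) volume volume := L.measurePreserving
  have h3 : MeasurePreserving (fun z : E3 => z + s) volume volume := measurePreserving_add_right volume s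
  exact h3.comp (h2.comp h1)

/-- **(M4-fcc) Every site of a moved fcc stacking has a twelve-neighbour cell of volume `√2/2 = 1/√2`.** -/
theorem volume_cell₁₂_of_mem_stacking_constHagg {L : E3 ≃ₗᵢ[ℝ] E3} {s a : E3} (ha : a ∈ stacking L s constHagg) :
    volume {z : E3 | ∀ v ∈ stacking L s constHagg, dist a v = 1 → dist z a < dist z v} = ENNReal.ofReal (Real.sqrt 2 / 2) := by
  obtain ⟨r, hr, rfl⟩ := ha
  change r ∈ fccRef at hr
  rw [cell₁₂_eq_image hr]
  set e : E3 ≃ᵐ E3 := ((Homeomorph.addLeft r).trans (L.toHomeomorph.trans (Homeomorph.addRight s))).toMeasurableEquiv with he_def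
  have hecoe : (fun z : E3 => L (r + z) + s) = ⇑e := rfl
  have he : MeasurePreserving (⇑e) volume volume := hecoe ▸ measurePreserving_move L s r
  rw [hecoe, MeasurableEquiv.image_eq_preimage_symm, (he.symm e).measure_preimage_equiv, volume_cell₁₂_fccRef_zero]

end Summit.Ventures.Crystal3D.Cruxes.TextureLiminf.TexShadow

end
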